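import Summits.ValiantsHypothesis.ValiantsHypothesis.Theorems.GrenetZeonDualUnipotentThreeHalvesHeavyTopInstFourSevenDefs
import Summits.ValiantsHypothesis.ValiantsHypothesis.Theorems.GrenetZeonDualUnipotentThreeHalvesHeavyTopInstFourSevenToolkit

/-!
# `GrenetZeon.DualUnipotentThreeHalves` (stmt-ValiantsHypothesis-24318) — line «radical_split» §8, instance table of R2:
# BUDGET ONE, the pivot dichotomies and the isolated two-paths of the far-corner `(4,7)` pencil

24318 `HeavyTopLaw` INSTRUMENT (director-valiant g13 R259 (a) / R263; the cut named by the instrument pen val-port-3 g2, 15:14Z: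
«the (4,7) far-corner NEGATIVE certificate on the ✓ p635270 template — word certificates of length ≤ 3»; this file val-port-2 g2,
val-lit merged desk b71 (B) port pool).  Part of the chain `…GrenetZeonDualUnipotentThreeHalvesHeavyTopInstFourSeven{Defs, Toolkit, Blocks, BudgetOne}` (flat helper files) →
`…DualUnipotentThreeHalves/Negative/HeavyTopInstFourSeven` (`¬ HeavyTopInst 4 7`, Negative lane).

* `topSeven_single_ab` — the seven pivots: `topSeven (e_c) = E_{ab}` for the coordinates `c` sitting at `(a,b) ∈ {(2,3),(2,4),(3,4),
  (3,5),(4,5),(4,6),(5,6)}` (0-indexed in the statements).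
* ★ `budgetOne_blocks` — if `Q·P·Q = 0` for every top `Q = topSeven v`, `v ∈ K`, and every `P` in the top space, then for each pivot
  `(a,b)` either the whole column `a` or the whole row `b` of coordinates dies on `K` (`(Q E_{ab} Q)_{ij} = Q_{ia}Q_{bj}` and the
  two-coordinate lemma ✓ `forall_apply_eq_zero_or`).
* `budgetOne_squares` — the entries `(0,3), (0,4), (0,5), (1,4)` of `Q² = 0` as coordinate identities on `K`.

Honest framing.  Helper lemmas for ONE tiny format of R2's instance table (`--supports stmt-ValiantsHypothesis-24318 --as helper`);
nothing here asserts or refutes R2 `HeavyTopLaw` (take `n₀ ≥ 5` or `C₀ ≥ 2` and `(4,7)` is discarded), S3b, the crux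
`DualUnipotentThreeHalves`, rung 8062 or `VP ≠ VNP` — all OPEN / NOT proved.
[this line's workfile §8; port-3 g2 `Cruxes/DualUnipotentThreeHalves/INSTANCES.md` v1 (5); ✓ `…Negative.HeavyTopInstThreeFive`; ✓ `…WordFlagPencil`]
-/

-- `Summit.ValiantsHypothesis.ValiantsHypothesis.…` repeats a component (D-0017 layout); `dupNamespace` would flag the mandated name.
set_option linter.dupNamespace false
set_option autoImplicit false

noncomputable section

namespace Summit.ValiantsHypothesis.ValiantsHypothesis.Theorems.GrenetZeon.RadicalSplit

open MvPolynomial Matrix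
open scoped BigOperators
open Summit.ValiantsHypothesis.ValiantsHypothesis.Cruxes.TwoDimCoefficients.DimTwoCases (AffMat IsAffine)

/-- The top in the coordinate direction `(1,0)` is the matrix unit `E₂₃ (pivot (2,3), coordinate x₂)` (0-indexed in the statement). -/
theorem topSeven_single_10 : topSeven (Pi.single ((1 : Fin 4), (0 : Fin 4)) (1 : ℂ)) = Matrix.single (1 : Fin 7) (2 : Fin 7) (1 : ℂ) := by
  ext i j; fin_cases i <;> fin_cases j <;> simp [topSeven, Matrix.single]

/-- The top in the coordinate direction `(1,1)` is the matrix unit `E₂₄ (pivot (2,4), coordinate y₂)` (0-indexed in the statement). -/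
theorem topSeven_single_11 : topSeven (Pi.single ((1 : Fin 4), (1 : Fin 4)) (1 : ℂ)) = Matrix.single (1 : Fin 7) (3 : Fin 7) (1 : ℂ) := by
  ext i j; fin_cases i <;> fin_cases j <;> simp [topSeven, Matrix.single]

/-- The top in the coordinate direction `(2,0)` is the matrix unit `E₃₄ (pivot (3,4), coordinate x₃)` (0-indexed in the statement). -/
theorem topSeven_single_20 : topSeven (Pi.single ((2 : Fin 4), (0 : Fin 4)) (1 : ℂ)) = Matrix.single (2 : Fin 7) (3 : Fin 7) (1 : ℂ) := by
  ext i j; fin_cases i <;> fin_cases j <;> simp [topSeven, Matrix.single]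

/-- The top in the coordinate direction `(2,1)` is the matrix unit `E₃₅ (pivot (3,5), coordinate y₃)` (0-indexed in the statement). -/
theorem topSeven_single_21 : topSeven (Pi.single ((2 : Fin 4), (1 : Fin 4)) (1 : ℂ)) = Matrix.single (2 : Fin 7) (4 : Fin 7) (1 : ℂ) := by
  ext i j; fin_cases i <;> fin_cases j <;> simp [topSeven, Matrix.single]

/-- The top in the coordinate direction `(3,0)` is the matrix unit `E₄₅ (pivot (4,5), coordinate x₄)` (0-indexed in the statement). -/
theorem topSeven_single_30 : topSeven (Pi.single ((3 : Fin 4), (0 : Fin 4)) (1 : ℂ)) = Matrix.single (3 : Fin 7) (4 : Fin 7) (1 : ℂ) := by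
  ext i j; fin_cases i <;> fin_cases j <;> simp [topSeven, Matrix.single]

/-- The top in the coordinate direction `(3,1)` is the matrix unit `E₄₆ (pivot (4,6), coordinate y₄)` (0-indexed in the statement). -/
theorem topSeven_single_31 : topSeven (Pi.single ((3 : Fin 4), (1 : Fin 4)) (1 : ℂ)) = Matrix.single (3 : Fin 7) (5 : Fin 7) (1 : ℂ) := by
  ext i j; fin_cases i <;> fin_cases j <;> simp [topSeven, Matrix.single]

/-- The top in the coordinate direction `(1,3)` is the matrix unit `E₅₆ (pivot (5,6), coordinate x₅)` (0-indexed in the statement). -/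
theorem topSeven_single_13 : topSeven (Pi.single ((1 : Fin 4), (3 : Fin 4)) (1 : ℂ)) = Matrix.single (4 : Fin 7) (5 : Fin 7) (1 : ℂ) := by
  ext i j; fin_cases i <;> fin_cases j <;> simp [topSeven, Matrix.single]

/-- **Pivot dichotomies.**  If `Q·P·Q = 0` for every top `Q = topSeven v`, `v ∈ K`, and every `P` in the top space, then for
each of the seven pivots `(a,b) ∈ {(2,3),(2,4),(3,4),(3,5),(4,5),(4,6),(5,6)}` (with `P = E_{ab}`: `(Q E_{ab} Q)_{ij} = Q_{ia} Q_{bj}`)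
either every coordinate of column `a` or every coordinate of row `b` vanishes identically on `K`. [this file] -/
theorem budgetOne_blocks (K : Submodule ℂ (Fin 4 × Fin 4 → ℂ))
    (hqpq : ∀ x : Fin 4 × Fin 4 → ℂ, ∀ v ∈ K, topSeven v * topSeven x * topSeven v = 0) :
    ((∀ a : Fin 1, ∀ v ∈ K, v (![((0 : Fin 4), (0 : Fin 4))] a) = 0) ∨ (∀ b : Fin 3, ∀ v ∈ K, v (![((2 : Fin 4), (0 : Fin 4)), ((2 : Fin 4), (1 : Fin 4)), ((2 : Fin 4), (2 : Fin 4))] b) = 0)) ∧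
    ((∀ a : Fin 1, ∀ v ∈ K, v (![((0 : Fin 4), (0 : Fin 4))] a) = 0) ∨ (∀ b : Fin 3, ∀ v ∈ K, v (![((3 : Fin 4), (0 : Fin 4)), ((3 : Fin 4), (1 : Fin 4)), ((3 : Fin 4), (2 : Fin 4))] b) = 0)) ∧
    ((∀ a : Fin 2, ∀ v ∈ K, v (![((0 : Fin 4), (1 : Fin 4)), ((1 : Fin 4), (0 : Fin 4))] a) = 0) ∨ (∀ b : Fin 3, ∀ v ∈ K, v (![((3 : Fin 4), (0 : Fin 4)), ((3 : Fin 4), (1 : Fin 4)), ((3 : Fin 4), (2 : Fin 4))] b) = 0)) ∧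
    ((∀ a : Fin 2, ∀ v ∈ K, v (![((0 : Fin 4), (1 : Fin 4)), ((1 : Fin 4), (0 : Fin 4))] a) = 0) ∨ (∀ b : Fin 2, ∀ v ∈ K, v (![((1 : Fin 4), (3 : Fin 4)), ((2 : Fin 4), (3 : Fin 4))] b) = 0)) ∧
    ((∀ a : Fin 3, ∀ v ∈ K, v (![((0 : Fin 4), (2 : Fin 4)), ((1 : Fin 4), (1 : Fin 4)), ((2 : Fin 4), (0 : Fin 4))] a) = 0) ∨ (∀ b : Fin 2, ∀ v ∈ K, v (![((1 : Fin 4), (3 : Fin 4)), ((2 : Fin 4), (3 : Fin 4))] b) = 0)) ∧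
    ((∀ a : Fin 3, ∀ v ∈ K, v (![((0 : Fin 4), (2 : Fin 4)), ((1 : Fin 4), (1 : Fin 4)), ((2 : Fin 4), (0 : Fin 4))] a) = 0) ∨ (∀ b : Fin 1, ∀ v ∈ K, v (![((3 : Fin 4), (3 : Fin 4))] b) = 0)) ∧
    ((∀ a : Fin 4, ∀ v ∈ K, v (![((0 : Fin 4), (3 : Fin 4)), ((1 : Fin 4), (2 : Fin 4)), ((2 : Fin 4), (1 : Fin 4)), ((3 : Fin 4), (0 : Fin 4))] a) = 0) ∨ (∀ b : Fin 1, ∀ v ∈ K, v (![((3 : Fin 4), (3 : Fin 4))] b) = 0)) := by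
  classical
  have p_x1_x3 : ∀ v ∈ K, v (0,0) * v (2,0) = 0 := fun v hv => by
    have h := congr_fun (congr_fun (hqpq (Pi.single ((1 : Fin 4), (0 : Fin 4)) 1) v hv) 0) 3
    rw [topSeven_single_10, mul_single_mul_apply, Matrix.zero_apply] at h
    simpa [topSeven] using h
  have p_x1_y3 : ∀ v ∈ K, v (0,0) * v (2,1) = 0 := fun v hv => by
    have h := congr_fun (congr_fun (hqpq (Pi.single ((1 : Fin 4), (0 : Fin 4)) 1) v hv) 0) 4
    rw [topSeven_single_10, mul_single_mul_apply, Matrix.zero_apply] at h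
    simpa [topSeven] using h
  have p_x1_z3 : ∀ v ∈ K, v (0,0) * v (2,2) = 0 := fun v hv => by
    have h := congr_fun (congr_fun (hqpq (Pi.single ((1 : Fin 4), (0 : Fin 4)) 1) v hv) 0) 5
    rw [topSeven_single_10, mul_single_mul_apply, Matrix.zero_apply] at h
    simpa [topSeven] using h
  have p_x1_x4 : ∀ v ∈ K, v (0,0) * v (3,0) = 0 := fun v hv => by
    have h := congr_fun (congr_fun (hqpq (Pi.single ((1 : Fin 4), (1 : Fin 4)) 1) v hv) 0) 4
    rw [topSeven_single_11, mul_single_mul_apply, Matrix.zero_apply] at h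
    simpa [topSeven] using h
  have p_x1_y4 : ∀ v ∈ K, v (0,0) * v (3,1) = 0 := fun v hv => by
    have h := congr_fun (congr_fun (hqpq (Pi.single ((1 : Fin 4), (1 : Fin 4)) 1) v hv) 0) 5
    rw [topSeven_single_11, mul_single_mul_apply, Matrix.zero_apply] at h
    simpa [topSeven] using h
  have p_x1_z4 : ∀ v ∈ K, v (0,0) * v (3,2) = 0 := fun v hv => by
    have h := congr_fun (congr_fun (hqpq (Pi.single ((1 : Fin 4), (1 : Fin 4)) 1) v hv) 0) 6
    rw [topSeven_single_11, mul_single_mul_apply, Matrix.zero_apply] at h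
    simpa [topSeven] using h
  have p_y1_x4 : ∀ v ∈ K, v (0,1) * v (3,0) = 0 := fun v hv => by
    have h := congr_fun (congr_fun (hqpq (Pi.single ((2 : Fin 4), (0 : Fin 4)) 1) v hv) 0) 4
    rw [topSeven_single_20, mul_single_mul_apply, Matrix.zero_apply] at h
    simpa [topSeven] using h
  have p_y1_y4 : ∀ v ∈ K, v (0,1) * v (3,1) = 0 := fun v hv => by
    have h := congr_fun (congr_fun (hqpq (Pi.single ((2 : Fin 4), (0 : Fin 4)) 1) v hv) 0) 5
    rw [topSeven_single_20, mul_single_mul_apply, Matrix.zero_apply] at h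
    simpa [topSeven] using h
  have p_y1_z4 : ∀ v ∈ K, v (0,1) * v (3,2) = 0 := fun v hv => by
    have h := congr_fun (congr_fun (hqpq (Pi.single ((2 : Fin 4), (0 : Fin 4)) 1) v hv) 0) 6
    rw [topSeven_single_20, mul_single_mul_apply, Matrix.zero_apply] at h
    simpa [topSeven] using h
  have p_x2_x4 : ∀ v ∈ K, v (1,0) * v (3,0) = 0 := fun v hv => by
    have h := congr_fun (congr_fun (hqpq (Pi.single ((2 : Fin 4), (0 : Fin 4)) 1) v hv) 1) 4
    rw [topSeven_single_20, mul_single_mul_apply, Matrix.zero_apply] at h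
    simpa [topSeven] using h
  have p_x2_y4 : ∀ v ∈ K, v (1,0) * v (3,1) = 0 := fun v hv => by
    have h := congr_fun (congr_fun (hqpq (Pi.single ((2 : Fin 4), (0 : Fin 4)) 1) v hv) 1) 5
    rw [topSeven_single_20, mul_single_mul_apply, Matrix.zero_apply] at h
    simpa [topSeven] using h
  have p_x2_z4 : ∀ v ∈ K, v (1,0) * v (3,2) = 0 := fun v hv => by
    have h := congr_fun (congr_fun (hqpq (Pi.single ((2 : Fin 4), (0 : Fin 4)) 1) v hv) 1) 6
    rw [topSeven_single_20, mul_single_mul_apply, Matrix.zero_apply] at h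
    simpa [topSeven] using h
  have p_y1_x5 : ∀ v ∈ K, v (0,1) * v (1,3) = 0 := fun v hv => by
    have h := congr_fun (congr_fun (hqpq (Pi.single ((2 : Fin 4), (1 : Fin 4)) 1) v hv) 0) 5
    rw [topSeven_single_21, mul_single_mul_apply, Matrix.zero_apply] at h
    simpa [topSeven] using h
  have p_y1_y5 : ∀ v ∈ K, v (0,1) * v (2,3) = 0 := fun v hv => by
    have h := congr_fun (congr_fun (hqpq (Pi.single ((2 : Fin 4), (1 : Fin 4)) 1) v hv) 0) 6
    rw [topSeven_single_21, mul_single_mul_apply, Matrix.zero_apply] at h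
    simpa [topSeven] using h
  have p_x2_x5 : ∀ v ∈ K, v (1,0) * v (1,3) = 0 := fun v hv => by
    have h := congr_fun (congr_fun (hqpq (Pi.single ((2 : Fin 4), (1 : Fin 4)) 1) v hv) 1) 5
    rw [topSeven_single_21, mul_single_mul_apply, Matrix.zero_apply] at h
    simpa [topSeven] using h
  have p_x2_y5 : ∀ v ∈ K, v (1,0) * v (2,3) = 0 := fun v hv => by
    have h := congr_fun (congr_fun (hqpq (Pi.single ((2 : Fin 4), (1 : Fin 4)) 1) v hv) 1) 6
    rw [topSeven_single_21, mul_single_mul_apply, Matrix.zero_apply] at h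
    simpa [topSeven] using h
  have p_z1_x5 : ∀ v ∈ K, v (0,2) * v (1,3) = 0 := fun v hv => by
    have h := congr_fun (congr_fun (hqpq (Pi.single ((3 : Fin 4), (0 : Fin 4)) 1) v hv) 0) 5
    rw [topSeven_single_30, mul_single_mul_apply, Matrix.zero_apply] at h
    simpa [topSeven] using h
  have p_z1_y5 : ∀ v ∈ K, v (0,2) * v (2,3) = 0 := fun v hv => by
    have h := congr_fun (congr_fun (hqpq (Pi.single ((3 : Fin 4), (0 : Fin 4)) 1) v hv) 0) 6
    rw [topSeven_single_30, mul_single_mul_apply, Matrix.zero_apply] at h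
    simpa [topSeven] using h
  have p_y2_x5 : ∀ v ∈ K, v (1,1) * v (1,3) = 0 := fun v hv => by
    have h := congr_fun (congr_fun (hqpq (Pi.single ((3 : Fin 4), (0 : Fin 4)) 1) v hv) 1) 5
    rw [topSeven_single_30, mul_single_mul_apply, Matrix.zero_apply] at h
    simpa [topSeven] using h
  have p_y2_y5 : ∀ v ∈ K, v (1,1) * v (2,3) = 0 := fun v hv => by
    have h := congr_fun (congr_fun (hqpq (Pi.single ((3 : Fin 4), (0 : Fin 4)) 1) v hv) 1) 6
    rw [topSeven_single_30, mul_single_mul_apply, Matrix.zero_apply] at h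
    simpa [topSeven] using h
  have p_x3_x5 : ∀ v ∈ K, v (2,0) * v (1,3) = 0 := fun v hv => by
    have h := congr_fun (congr_fun (hqpq (Pi.single ((3 : Fin 4), (0 : Fin 4)) 1) v hv) 2) 5
    rw [topSeven_single_30, mul_single_mul_apply, Matrix.zero_apply] at h
    simpa [topSeven] using h
  have p_x3_y5 : ∀ v ∈ K, v (2,0) * v (2,3) = 0 := fun v hv => by
    have h := congr_fun (congr_fun (hqpq (Pi.single ((3 : Fin 4), (0 : Fin 4)) 1) v hv) 2) 6
    rw [topSeven_single_30, mul_single_mul_apply, Matrix.zero_apply] at h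
    simpa [topSeven] using h
  have p_z1_x6 : ∀ v ∈ K, v (0,2) * v (3,3) = 0 := fun v hv => by
    have h := congr_fun (congr_fun (hqpq (Pi.single ((3 : Fin 4), (1 : Fin 4)) 1) v hv) 0) 6
    rw [topSeven_single_31, mul_single_mul_apply, Matrix.zero_apply] at h
    simpa [topSeven] using h
  have p_y2_x6 : ∀ v ∈ K, v (1,1) * v (3,3) = 0 := fun v hv => by
    have h := congr_fun (congr_fun (hqpq (Pi.single ((3 : Fin 4), (1 : Fin 4)) 1) v hv) 1) 6
    rw [topSeven_single_31, mul_single_mul_apply, Matrix.zero_apply] at h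
    simpa [topSeven] using h
  have p_x3_x6 : ∀ v ∈ K, v (2,0) * v (3,3) = 0 := fun v hv => by
    have h := congr_fun (congr_fun (hqpq (Pi.single ((3 : Fin 4), (1 : Fin 4)) 1) v hv) 2) 6
    rw [topSeven_single_31, mul_single_mul_apply, Matrix.zero_apply] at h
    simpa [topSeven] using h
  have p_w1_x6 : ∀ v ∈ K, v (0,3) * v (3,3) = 0 := fun v hv => by
    have h := congr_fun (congr_fun (hqpq (Pi.single ((1 : Fin 4), (3 : Fin 4)) 1) v hv) 0) 6
    rw [topSeven_single_13, mul_single_mul_apply, Matrix.zero_apply] at h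
    simpa [topSeven] using h
  have p_z2_x6 : ∀ v ∈ K, v (1,2) * v (3,3) = 0 := fun v hv => by
    have h := congr_fun (congr_fun (hqpq (Pi.single ((1 : Fin 4), (3 : Fin 4)) 1) v hv) 1) 6
    rw [topSeven_single_13, mul_single_mul_apply, Matrix.zero_apply] at h
    simpa [topSeven] using h
  have p_y3_x6 : ∀ v ∈ K, v (2,1) * v (3,3) = 0 := fun v hv => by
    have h := congr_fun (congr_fun (hqpq (Pi.single ((1 : Fin 4), (3 : Fin 4)) 1) v hv) 2) 6
    rw [topSeven_single_13, mul_single_mul_apply, Matrix.zero_apply] at h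
    simpa [topSeven] using h
  have p_x4_x6 : ∀ v ∈ K, v (3,0) * v (3,3) = 0 := fun v hv => by
    have h := congr_fun (congr_fun (hqpq (Pi.single ((1 : Fin 4), (3 : Fin 4)) 1) v hv) 3) 6
    rw [topSeven_single_13, mul_single_mul_apply, Matrix.zero_apply] at h
    simpa [topSeven] using h
  have blk23 : (∀ a : Fin 1, ∀ v ∈ K, v (![((0 : Fin 4), (0 : Fin 4))] a) = 0) ∨ (∀ b : Fin 3, ∀ v ∈ K, v (![((2 : Fin 4), (0 : Fin 4)), ((2 : Fin 4), (1 : Fin 4)), ((2 : Fin 4), (2 : Fin 4))] b) = 0) := by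
    refine forall_or_forall_of_forall_or fun a b => ?_
    fin_cases a; fin_cases b
    · simpa using forall_apply_eq_zero_or K (0,0) (2,0) p_x1_x3
    · simpa using forall_apply_eq_zero_or K (0,0) (2,1) p_x1_y3
    · simpa using forall_apply_eq_zero_or K (0,0) (2,2) p_x1_z3
  have blk24 : (∀ a : Fin 1, ∀ v ∈ K, v (![((0 : Fin 4), (0 : Fin 4))] a) = 0) ∨ (∀ b : Fin 3, ∀ v ∈ K, v (![((3 : Fin 4), (0 : Fin 4)), ((3 : Fin 4), (1 : Fin 4)), ((3 : Fin 4), (2 : Fin 4))] b) = 0) := by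
    refine forall_or_forall_of_forall_or fun a b => ?_
    fin_cases a; fin_cases b
    · simpa using forall_apply_eq_zero_or K (0,0) (3,0) p_x1_x4
    · simpa using forall_apply_eq_zero_or K (0,0) (3,1) p_x1_y4
    · simpa using forall_apply_eq_zero_or K (0,0) (3,2) p_x1_z4
  have blk34 : (∀ a : Fin 2, ∀ v ∈ K, v (![((0 : Fin 4), (1 : Fin 4)), ((1 : Fin 4), (0 : Fin 4))] a) = 0) ∨ (∀ b : Fin 3, ∀ v ∈ K, v (![((3 : Fin 4), (0 : Fin 4)), ((3 : Fin 4), (1 : Fin 4)), ((3 : Fin 4), (2 : Fin 4))] b) = 0) := by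
    refine forall_or_forall_of_forall_or fun a b => ?_
    fin_cases a <;> fin_cases b
    · simpa using forall_apply_eq_zero_or K (0,1) (3,0) p_y1_x4
    · simpa using forall_apply_eq_zero_or K (0,1) (3,1) p_y1_y4
    · simpa using forall_apply_eq_zero_or K (0,1) (3,2) p_y1_z4
    · simpa using forall_apply_eq_zero_or K (1,0) (3,0) p_x2_x4
    · simpa using forall_apply_eq_zero_or K (1,0) (3,1) p_x2_y4
    · simpa using forall_apply_eq_zero_or K (1,0) (3,2) p_x2_z4
  have blk35 : (∀ a : Fin 2, ∀ v ∈ K, v (![((0 : Fin 4), (1 : Fin 4)), ((1 : Fin 4), (0 : Fin 4))] a) = 0) ∨ (∀ b : Fin 2, ∀ v ∈ K, v (![((1 : Fin 4), (3 : Fin 4)), ((2 : Fin 4), (3 : Fin 4))] b) = 0) := by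
    refine forall_or_forall_of_forall_or fun a b => ?_
    fin_cases a <;> fin_cases b
    · simpa using forall_apply_eq_zero_or K (0,1) (1,3) p_y1_x5
    · simpa using forall_apply_eq_zero_or K (0,1) (2,3) p_y1_y5
    · simpa using forall_apply_eq_zero_or K (1,0) (1,3) p_x2_x5
    · simpa using forall_apply_eq_zero_or K (1,0) (2,3) p_x2_y5
  have blk45 : (∀ a : Fin 3, ∀ v ∈ K, v (![((0 : Fin 4), (2 : Fin 4)), ((1 : Fin 4), (1 : Fin 4)), ((2 : Fin 4), (0 : Fin 4))] a) = 0) ∨ (∀ b : Fin 2, ∀ v ∈ K, v (![((1 : Fin 4), (3 : Fin 4)), ((2 : Fin 4), (3 : Fin 4))] b) = 0) := by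
    refine forall_or_forall_of_forall_or fun a b => ?_
    fin_cases a <;> fin_cases b
    · simpa using forall_apply_eq_zero_or K (0,2) (1,3) p_z1_x5
    · simpa using forall_apply_eq_zero_or K (0,2) (2,3) p_z1_y5
    · simpa using forall_apply_eq_zero_or K (1,1) (1,3) p_y2_x5
    · simpa using forall_apply_eq_zero_or K (1,1) (2,3) p_y2_y5
    · simpa using forall_apply_eq_zero_or K (2,0) (1,3) p_x3_x5
    · simpa using forall_apply_eq_zero_or K (2,0) (2,3) p_x3_y5
  have blk46 : (∀ a : Fin 3, ∀ v ∈ K, v (![((0 : Fin 4), (2 : Fin 4)), ((1 : Fin 4), (1 : Fin 4)), ((2 : Fin 4), (0 : Fin 4))] a) = 0) ∨ (∀ b : Fin 1, ∀ v ∈ K, v (![((3 : Fin 4), (3 : Fin 4))] b) = 0) := by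
    refine forall_or_forall_of_forall_or fun a b => ?_
    fin_cases a <;> fin_cases b
    · simpa using forall_apply_eq_zero_or K (0,2) (3,3) p_z1_x6
    · simpa using forall_apply_eq_zero_or K (1,1) (3,3) p_y2_x6
    · simpa using forall_apply_eq_zero_or K (2,0) (3,3) p_x3_x6
  have blk56 : (∀ a : Fin 4, ∀ v ∈ K, v (![((0 : Fin 4), (3 : Fin 4)), ((1 : Fin 4), (2 : Fin 4)), ((2 : Fin 4), (1 : Fin 4)), ((3 : Fin 4), (0 : Fin 4))] a) = 0) ∨ (∀ b : Fin 1, ∀ v ∈ K, v (![((3 : Fin 4), (3 : Fin 4))] b) = 0) := by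
    refine forall_or_forall_of_forall_or fun a b => ?_
    fin_cases a <;> fin_cases b
    · simpa using forall_apply_eq_zero_or K (0,3) (3,3) p_w1_x6
    · simpa using forall_apply_eq_zero_or K (1,2) (3,3) p_z2_x6
    · simpa using forall_apply_eq_zero_or K (2,1) (3,3) p_y3_x6
    · simpa using forall_apply_eq_zero_or K (3,0) (3,3) p_x4_x6
  exact ⟨blk23, blk24, blk34, blk35, blk45, blk46, blk56⟩

/-- **Isolated two-paths.**  The entries `(0,3), (0,4), (0,5), (1,4)` of `Q² = 0`, `Q = topSeven v`, `v ∈ K`, as coordinate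
identities on `K`. [this file] -/
theorem budgetOne_squares (K : Submodule ℂ (Fin 4 × Fin 4 → ℂ)) (hsq : ∀ v ∈ K, topSeven v * topSeven v = 0) :
    (∀ v ∈ K, v (0,0) * v (1,1) + v (0,1) * v (2,0) = 0) ∧
    (∀ v ∈ K, v (0,0) * v (1,2) + v (0,1) * v (2,1) + v (0,2) * v (3,0) = 0) ∧
    (∀ v ∈ K, v (0,1) * v (2,2) + v (0,2) * v (3,1) + v (0,3) * v (1,3) = 0) ∧
    (∀ v ∈ K, v (1,0) * v (2,1) + v (1,1) * v (3,0) = 0) := by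
  refine ⟨?_, ?_, ?_, ?_⟩
  · intro v hv
    have h := congr_fun (congr_fun (hsq v hv) 0) 3
    simp [topSeven, Matrix.mul_apply, Fin.sum_univ_seven, -mul_eq_zero] at h
    linear_combination h
  · intro v hv
    have h := congr_fun (congr_fun (hsq v hv) 0) 4
    simp [topSeven, Matrix.mul_apply, Fin.sum_univ_seven, -mul_eq_zero] at h
    linear_combination h
  · intro v hv
    have h := congr_fun (congr_fun (hsq v hv) 0) 5
    simp [topSeven, Matrix.mul_apply, Fin.sum_univ_seven, -mul_eq_zero] at h
    linear_combination h
  · intro v hv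
    have h := congr_fun (congr_fun (hsq v hv) 1) 4
    simp [topSeven, Matrix.mul_apply, Fin.sum_univ_seven, -mul_eq_zero] at h
    linear_combination h

end Summit.ValiantsHypothesis.ValiantsHypothesis.Theorems.GrenetZeon.RadicalSplit

end
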